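import Summits.ResolutionOfSingularities.ResolutionOfSingularities.Theorems.PurelyInseparableDim4Target
import HarnessLib

/-!
# LINE `dim4-pi` — the sorry-free layer of the cell's skeleton (bricks TY-1 + PR-6 of `res-dim4-pi`)

[OURS · counted 0] Stated against the ONE target file `Theorems/PurelyInseparableDim4Target.lean`
(namespace `…Theorems.PIDim4`; director DR-157-C (2); desk `lines/dim4-pi/line-v2.lean` sha16
a68798e8cfd524fd, re-scoped by `boards/WAVE2.md` §F after WORD #17).

* `Line.S1 p := PIDim4.SecondaryInvariantExists p p` — the cell's question as typed (existence form).
* `Line.S2_holds : S1 p → PIDim4.Terminates1h p p` — PROVED (a strictly decreasing well-founded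
  invariant forbids an infinite MODE-1h branch).
* `Line.S1_of_terminates` (PR-6, converse of S2) and `Line.S1_iff_terminates`,
  `Line.S1_iff_wellFounded` (PR-6: `S1` ⟺ well-foundedness of the flipped MODE-1h step relation over
  every field of characteristic `p`) — PROVED; so `S1` as typed IS termination, and the cell's content is
  an EXPLICIT `Φ` (desk WORD #9), not the existence statement.
* `Line.S3 p := PIDim4.TerminationImpliesOrderReduction p` — the name of the scheme-level debt (chart
  dictionary TY-2, equimultiple points TY-3, globalisation); nothing about it is proved here.
* `Line.S1i p := PIDim4.SecondaryInvariantExistsSym p p` and `Line.S1_of_S1i` — PROVED (forget symmetry).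
* General exponent `q`: `terminates1h_iff_wellFounded`, `terminates1h_of_secondaryInvariantExists`,
  `secondaryInvariantExists_of_terminates1h`, `secondaryInvariantExists_iff_terminates1h`,
  `secondaryInvariantExists_of_sym`.

NOT here (desk §F): the stubs `stub_S1/stub_S3/stub_S1i` and the composition `orderReduction_of` —
at `p = 2` the hypothesis `S1 2` is REFUTED (`Theorems/PurelyInseparableDim4Mode1hTwoCycle.lean`,
crit-1 K-A-01: `¬ Terminates1h 2 2`, `¬ SecondaryInvariantExists 2 2`); the frame is being re-typed
over a centre RULE (desk Rules add-on, LINE v3). Nothing in this file proves resolution of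
singularities in dimension ≥ 4 / characteristic `p`; every statement is bookkeeping about OUR candidate
frame. Supports stmt-ResolutionOfSingularities-16155 (helper).
bears_on: LADDER-RESOLUTION:D157-DOOR2 (res-dim4-pi).
-/

set_option linter.dupNamespace false -- mandated namespace of this single-conjunct summit

namespace Summit.ResolutionOfSingularities.ResolutionOfSingularities.Theorems.PIDim4

/-! ## PR-6 at a general exponent `q`: termination = well-foundedness = existence of a secondary invariant -/

/-- `Terminates1h p q` (no infinite MODE-1h chain over any field of characteristic `p`) is equivalent to:
over every such field the flipped MODE-1h step relation `fun s' s => Step1h q s s'` is well-founded. -/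
theorem terminates1h_iff_wellFounded (p q : ℕ) :
    Terminates1h p q ↔ ∀ (K : Type) [Field K] [CharP K p] [DecidableEq K],
      WellFounded (flip (Step1h (K := K) q)) := by
  refine forall_congr' fun K => forall_congr' fun _ => forall_congr' fun _ => forall_congr' fun _ => ?_
  rw [wellFounded_iff_isEmpty_descending_chain, not_exists]
  constructor
  · intro h
    exact ⟨fun ⟨c, hc⟩ => h c hc⟩
  · intro h c hc
    exact h.false ⟨c, hc⟩

/-- **S2 at a general exponent**: a secondary invariant (a well-founded order and a `Φ` dropping strictly
across every MODE-1h step) forbids an infinite MODE-1h chain. -/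
theorem terminates1h_of_secondaryInvariantExists (p q : ℕ) :
    SecondaryInvariantExists p q → Terminates1h p q := by
  intro h K _ _ _ hc
  obtain ⟨c, hc⟩ := hc
  obtain ⟨W, lt, hwf, Φ, hΦ⟩ := h K
  exact (wellFounded_iff_isEmpty_descending_chain.mp hwf).false
    ⟨fun k => Φ (c k), fun k => hΦ _ _ (hc k)⟩

/-- **PR-6, converse of S2 at a general exponent**: termination gives a secondary invariant — take
`W := State K`, `lt :=` the flipped step relation (well-founded by termination) and `Φ := id`. So
`SecondaryInvariantExists` as typed is the EXISTENCE form of termination. -/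
theorem secondaryInvariantExists_of_terminates1h (p q : ℕ) :
    Terminates1h p q → SecondaryInvariantExists p q := by
  intro hT K _ _ _
  refine ⟨State K, fun a b => Step1h q b a, ?_, id, fun s s' h => h⟩
  exact (terminates1h_iff_wellFounded p q).mp hT K

/-- `SecondaryInvariantExists p q ↔ Terminates1h p q`. -/
theorem secondaryInvariantExists_iff_terminates1h (p q : ℕ) :
    SecondaryInvariantExists p q ↔ Terminates1h p q :=
  ⟨terminates1h_of_secondaryInvariantExists p q, secondaryInvariantExists_of_terminates1h p q⟩

/-- A renaming-invariant secondary invariant is in particular a secondary invariant. -/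
theorem secondaryInvariantExists_of_sym (p q : ℕ) :
    SecondaryInvariantExistsSym p q → SecondaryInvariantExists p q := by
  intro h K _ _ _
  obtain ⟨W, lt, hwf, Φ, hΦ, -⟩ := h K
  exact ⟨W, lt, hwf, Φ, hΦ⟩

/-! ## The line's vocabulary at `q = p` (LINE dim4-pi v2, sorry-free part) -/

namespace Line

/-- **S1** — the crux of the cell as typed: a presentation-relative secondary invariant for MODE 1h at
`q = p` (`PIDim4.SecondaryInvariantExists p p`). [OURS · CANDIDATE FRAME] -/
abbrev S1 (p : ℕ) : Prop := SecondaryInvariantExists p p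

/-- **S3** — termination of MODE 1h at `q = p` implies the scheme-level order-`p` reduction
(`PIDim4.TerminationImpliesOrderReduction p`; the line's scheme-level debt: chart dictionary,
equimultiple points = order-`p` points, globalisation). [OURS · CANDIDATE FRAME] -/
abbrev S3 (p : ℕ) : Prop := TerminationImpliesOrderReduction p

/-- **S1i** — support: a renaming-invariant secondary invariant (`PIDim4.SecondaryInvariantExistsSym p p`).
[OURS · CANDIDATE FRAME] -/
abbrev S1i (p : ℕ) : Prop := SecondaryInvariantExistsSym p p

/-- **S2 — PROVED**: `S1 p` forbids an infinite MODE-1h branch at `q = p`. -/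
theorem S2_holds (p : ℕ) : S1 p → Terminates1h p p :=
  terminates1h_of_secondaryInvariantExists p p

/-- **PR-6 — PROVED** (converse of S2): termination of MODE 1h at `q = p` gives `S1 p`. -/
theorem S1_of_terminates (p : ℕ) : Terminates1h p p → S1 p :=
  secondaryInvariantExists_of_terminates1h p p

/-- `S1 p ↔ Terminates1h p p`: `S1` as typed is exactly termination of the MODE-1h game at `q = p`. -/
theorem S1_iff_terminates (p : ℕ) : S1 p ↔ Terminates1h p p :=
  secondaryInvariantExists_iff_terminates1h p p

/-- **PR-6 — PROVED**: `S1 p` is equivalent to well-foundedness of the flipped MODE-1h step relation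
`fun s' s => Step1h p s s'` over every field of characteristic `p`. -/
theorem S1_iff_wellFounded (p : ℕ) :
    S1 p ↔ ∀ (K : Type) [Field K] [CharP K p] [DecidableEq K],
      WellFounded (flip (Step1h (K := K) p)) :=
  (secondaryInvariantExists_iff_terminates1h p p).trans (terminates1h_iff_wellFounded p p)

/-- `S1i p → S1 p` (forget the symmetry). -/
theorem S1_of_S1i (p : ℕ) (h : S1i p) : S1 p :=
  secondaryInvariantExists_of_sym p p h

end Line

end Summit.ResolutionOfSingularities.ResolutionOfSingularities.Theorems.PIDim4
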